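import Summits.BirchSwinnertonDyer.BirchSwinnertonDyer.Theorems.SignedLowerHalvesSprungLowerDivisibilityAtThreeRobustBezoutDoor
import Summits.BirchSwinnertonDyer.BirchSwinnertonDyer.Theorems.SignedLowerHalvesKobayashiLowerHalfSemistableDefectPrime
import Summits.BirchSwinnertonDyer.BirchSwinnertonDyer.Theorems.SignedLowerHalvesSprungLowerDivisibilityAtThreeCyclotomicCertOfLambda
import Summits.BirchSwinnertonDyer.Rank1Residual.Supersingular.MazurTateCertificates
import Literature.NumberTheory.EllipticCurves.PlusMinusPAdicLFunctionProofs
import Literature.NumberTheory.EllipticCurves.Wuthrich2014.PAdicBSDInequalityProofs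
import HarnessLib

/-!
# Crux `SprungLowerDivisibilityAtThree` (K1, item stmt-BirchSwinnertonDyer-19875), line `chromatic-common-zeros`:
# the robust Bézout door ON EXACT MAZUR–TATE DATA — `ω_n ∈ (p, T^l)^{n−j₀+1}` and the turnkey (RB0-MT)

Cell `bsd-ssimc` (host), width seat `cruxlead-stmt-BirchSwinnertonDyer-19875-w2` (g4) under the 19875 lead;
`--supports` 19875 `--as helper`; THEOREMS ONLY; closes NO item; registry unchanged (skeleton v8). K1, Sprung's main
conjecture, BSD and leaf X8 are NOT proved by anything here; every per-pair hypothesis is a displayed DATUM.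

Why: the graded door RB0 (`…RobustBezoutDoor`: `a·L♯ + b·L♭ − p^k ∈ J^{k+1}`, `J = (p, T^{λ})`) speaks about Sprung's
pair, which data owners know only through the Mazur–Tate elements `θ_n(f)` (exact rational polynomials). Since
`θ_n = ι(ω_n·Q_n − (u_n·L♯ + v_n·L♭))` integrally (`exists_integral_mazurTate_of_isSprungPair`) and `ω_n ∈ J^{n−j₀+1}`
once `p^{j₀} ≥ l` (§1), ANY identity `a·θ_{n₁} + b·θ_{n₂} − p^k ∈ ι(J^{k+1})` with `a, b ∈ ℤ[T]`, `n₁, n₂ ≥ j₀ + k` IS a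
graded certificate for `(L♯, L♭)` — no `p`-adic reconstruction of `L♯, L♭` at all.

## What is proved

* §1 (general `p`, pure algebra, namespace `…ChromaticRobustBezout`): `mem_certIdeal_of_forall_dvd_coeff` (`p ∣ F_i`,
  `i < l` ⟹ `F ∈ J_l := (C p, T^l)`); `coe_cyclotomic_comp_mem_certIdeal` (`l ≤ φ(p^{i+1})` ⟹ `Φ_{p^{i+1}}(1+T) ∈ J_l`);
  `red_toIwasawa_cyclotomicOmega` (`ω_n ≡ T^{pⁿ}`); **`toIwasawa_cyclotomicOmega_mem_certIdeal_pow`** (`l ≤ p^{j₀}` ⟹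
  `ω_{j₀+d} ∈ J_l^{d+1}`); **`exists_mem_certIdeal_pow_of_padicValRat`** (a rational polynomial whose coefficient `i` is
  `0` or has `v_p ≥ k+1−⌊i/l⌋` is `ι(E)` for some `E ∈ J_l^{k+1}` — the EXACT-RATIONAL entry of the certificate).
* §2 (general `p ∣ a_p`, `p ≠ 2`; namespace `…ChromaticCommonZeros`): **`exists_gradedBezout_of_mazurTate`** — for a
  Sprung pair, `ω_{n₁}, ω_{n₂} ∈ J_l^{k+1}` and `a·θ_{n₁} + b·θ_{n₂} − p^k = ι(E)`, `E ∈ J_l^{k+1}` ⟹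
  `∃ A B, A·L♯ + B·L♭ − C(p^k) ∈ J_l^{k+1}`.
* §3 (X8): **(RB0-MT) `sprungSharpFlatLowerDivisibility_of_mazurTateBezout`** — per newform: ONE Mazur–Tate layer reading
  `μ(L^•) = 0`, `λ(L^•) = l` (odd layer for `♯`, even for `♭`; `lam_{sharp,flat}_eq_of_mazurTate'`), `l ≤ p^{j₀}`, layers
  `n₁, n₂ ≥ j₀ + k`, `a, b ∈ ℤ[T]`, `E ∈ J_l^{k+1}` with `ι E = a·θ_{n₁} + b·θ_{n₂} − p^k` ⟹ K1 for BOTH colours (via RB0);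
  **`…_of_mazurTateBezout_padicVal`**: `E` replaced by the coefficientwise valuation test on the RATIONAL polynomial
  `a·θ_{n₁} + b·θ_{n₂} − p^k`. CONDITIONAL on `h714`, `h3`, `hJ` (as R0/RB0). Inputs: exact rationals only.

References: [Sprung2017] Thm. 1.12, Cor. 4.4, 4.10; [Pollack2003] Prop. 6.9, 6.10, 6.18; [Sprung2012] Thm. 7.14 (3), Prop. 7.19;
[Washington1997] §7.1, §13.2; [KuriharaPollack2007] Problem 3.2; tree: `…RobustBezout(Door)` (p629465, p630133, p630933),
`Rank1Residual/Supersingular/MazurTateLambdaReading`, `…/MazurTateCertificates`, `…DefectPrime`, `…CyclotomicCertOfLambda`.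
-/

set_option autoImplicit false
-- justification: the mandated namespace `Summit.BirchSwinnertonDyer.BirchSwinnertonDyer.Theorems`
-- (single-conjunct summit, Sub = Summit) repeats a segment by design (D-0017).
set_option linter.dupNamespace false

noncomputable section

open scoped Classical NumberField MatrixGroups ModularForm Polynomial

open NumberField IsDedekindDomain CongruenceSubgroup WeierstrassCurve Field Polynomial
  Literature.NumberTheory.EllipticCurves Literature.NumberTheory.EllipticCurves.ModularForms
  Literature.NumberTheory.EllipticCurves.ZpExtension Literature.NumberTheory.EllipticCurves.Sprung2017
  Literature.NumberTheory.EllipticCurves.Sprung2012 Literature.NumberTheory.EllipticCurves.Rank1Residual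
  Literature.NumberTheory.EllipticCurves.IwasawaAlgebra
  Summit.BirchSwinnertonDyer.BirchSwinnertonDyer.Theorems
  Summit.BirchSwinnertonDyer.Rank1Residual.Supersingular
  Summit.BirchSwinnertonDyer.Rank1Residual.X1.MuLambda
  Summit.BirchSwinnertonDyer.Rank1Residual.Iwasawa
  Summit.BirchSwinnertonDyer.BirchSwinnertonDyer.Theorems.ChromaticSlopeSeparation

/-! ### §1 `ω_n` and the graded certificate ideal `J_l = (p, T^l)`; the exact-rational entry -/
namespace Summit.BirchSwinnertonDyer.BirchSwinnertonDyer.Theorems.ChromaticRobustBezout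

section Omega

variable {p : ℕ} [hp : Fact p.Prime]

/-- **`F ∈ (p, T^l)` when `p ∣ F_i` for all `i < l`**: `F = T^l·V + Q` with `Q` the truncation below `l`, divisible by
`p`. [cite: Washington1997, §7.1] -/
theorem mem_certIdeal_of_forall_dvd_coeff {F : IwasawaAlgebra p} {l : ℕ}
    (h : ∀ i < l, (p : ℤ_[p]) ∣ PowerSeries.coeff i F) :
    F ∈ Ideal.span {(PowerSeries.C (p : ℤ_[p]) : IwasawaAlgebra p), PowerSeries.X ^ l} := by
  have hdec : F = PowerSeries.X ^ l * (PowerSeries.mk fun i => PowerSeries.coeff (i + l) F) +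
      ((PowerSeries.trunc l F : ℤ_[p][X]) : PowerSeries ℤ_[p]) := PowerSeries.eq_X_pow_mul_shift_add_trunc l F
  have hQ : (PowerSeries.C (p : ℤ_[p]) : IwasawaAlgebra p) ∣
      ((PowerSeries.trunc l F : ℤ_[p][X]) : PowerSeries ℤ_[p]) := by
    rw [← red_eq_zero_iff]
    ext m
    rw [PowerSeries.coeff_map, map_zero, Polynomial.coeff_coe, PowerSeries.coeff_trunc]
    split_ifs with hm
    · obtain ⟨c, hc⟩ := h m hm
      rw [hc, IsLocalRing.residue_eq_zero_iff, PadicInt.maximalIdeal_eq_span_p]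
      exact Ideal.mul_mem_right _ _ (Ideal.mem_span_singleton_self _)
    · exact map_zero _
  obtain ⟨c, hc⟩ := hQ
  rw [hdec, hc, Ideal.mem_span_insert]
  refine ⟨c, PowerSeries.X ^ l * (PowerSeries.mk fun i => PowerSeries.coeff (i + l) F),
    Ideal.mem_span_singleton'.mpr ⟨PowerSeries.mk fun i => PowerSeries.coeff (i + l) F, mul_comm _ _⟩, ?_⟩
  ring

/-- **`Φ_{p^{i+1}}(1+T) ∈ (p, T^l)` for `l ≤ φ(p^{i+1})`** (`Φ_{p^{i+1}}(1+T) ≡ T^{φ(p^{i+1})} (mod p)`,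
`DefectPrime.red_coe_cyclotomic_comp`). [cite: Washington1997, §7.1] -/
theorem coe_cyclotomic_comp_mem_certIdeal {i l : ℕ} (hl : l ≤ (p ^ (i + 1)).totient) :
    ((((cyclotomic (p ^ (i + 1)) ℤ_[p]).comp (X + 1) : ℤ_[p][X])) : IwasawaAlgebra p) ∈
      Ideal.span {(PowerSeries.C (p : ℤ_[p]) : IwasawaAlgebra p), PowerSeries.X ^ l} := by
  apply mem_certIdeal_of_forall_dvd_coeff
  intro m hm
  have hc : PowerSeries.coeff m
      (red ((((cyclotomic (p ^ (i + 1)) ℤ_[p]).comp (X + 1) : ℤ_[p][X])) : IwasawaAlgebra p)) = 0 := by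
    rw [DefectPrime.red_coe_cyclotomic_comp, PowerSeries.coeff_X_pow, if_neg (by omega)]
  rw [PowerSeries.coeff_map, IsLocalRing.residue_eq_zero_iff, PadicInt.maximalIdeal_eq_span_p,
    Ideal.mem_span_singleton] at hc
  exact hc

/-- **`ω_n ≡ T^{pⁿ} (mod p)`**: `red(ω_n) = T^{pⁿ}` in `𝔽_p⟦T⟧` (`ω_0 = T`, `ω_{n+1} = ω_n·Φ_{p^{n+1}}(1+T)` and
`Φ_{p^{n+1}}(1+T) ≡ T^{pⁿ(p−1)}`). [cite: Pollack2003, Thm. 6.17] -/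
theorem red_toIwasawa_cyclotomicOmega (n : ℕ) :
    red (toIwasawa p (cyclotomicOmega p n)) = PowerSeries.X ^ (p ^ n) := by
  induction n with
  | zero =>
    have h0 : cyclotomicOmega p 0 = X := by rw [cyclotomicOmega, pow_zero, pow_one, add_sub_cancel_right]
    rw [h0, toIwasawa_apply, Polynomial.map_X, Polynomial.coe_X, pow_zero, pow_one]
    change PowerSeries.map _ PowerSeries.X = PowerSeries.X
    exact PowerSeries.map_X _
  | succ n ih =>
    have hmul : toIwasawa p (cyclotomicOmega p (n + 1)) = toIwasawa p (cyclotomicOmega p n) *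
        ((((cyclotomic (p ^ (n + 1)) ℤ_[p]).comp (X + 1) : ℤ_[p][X])) : IwasawaAlgebra p) := by
      rw [cyclotomicOmega_succ, map_mul, toIwasawa_apply ((cyclotomic (p ^ (n + 1)) ℤ).comp (X + 1)),
        ChromaticCommonZeros.coe_map_cyclotomic_comp_eq]
    have hred : red (toIwasawa p (cyclotomicOmega p (n + 1))) = red (toIwasawa p (cyclotomicOmega p n)) *
        red ((((cyclotomic (p ^ (n + 1)) ℤ_[p]).comp (X + 1) : ℤ_[p][X])) : IwasawaAlgebra p) := by
      rw [hmul]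
      exact map_mul (PowerSeries.map (IsLocalRing.residue ℤ_[p])) _ _
    rw [hred, ih, DefectPrime.red_coe_cyclotomic_comp, ← pow_add, Nat.totient_prime_pow_succ hp.out]
    congr 1
    have h1 : 1 ≤ p := hp.out.one_lt.le
    calc p ^ n + p ^ n * (p - 1) = p ^ n * (1 + (p - 1)) := by ring
      _ = p ^ n * p := by rw [Nat.add_sub_cancel' h1]
      _ = p ^ (n + 1) := by rw [pow_succ]

/-- **`ω_{j₀+d} ∈ (p, T^l)^{d+1}` whenever `l ≤ p^{j₀}`**: `ω_{j₀} ≡ T^{p^{j₀}} (mod p)` lies in `J_l`, and so does each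
further factor `Φ_{p^{j}}(1+T)`, `j > j₀` (`φ(p^j) ≥ p^{j₀} ≥ l`) — the precision the Mazur–Tate congruence carries at layer
`n = j₀ + d`. [cite: Pollack2003, Thm. 6.17 and Prop. 6.18] -/
theorem toIwasawa_cyclotomicOmega_mem_certIdeal_pow {l j₀ : ℕ} (hl : l ≤ p ^ j₀) (d : ℕ) :
    toIwasawa p (cyclotomicOmega p (j₀ + d)) ∈
      (Ideal.span {(PowerSeries.C (p : ℤ_[p]) : IwasawaAlgebra p), PowerSeries.X ^ l}) ^ (d + 1) := by
  induction d with
  | zero =>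
    rw [add_zero, zero_add, pow_one]
    apply mem_certIdeal_of_forall_dvd_coeff
    intro m hm
    have hc : PowerSeries.coeff m (red (toIwasawa p (cyclotomicOmega p j₀))) = 0 := by
      rw [red_toIwasawa_cyclotomicOmega, PowerSeries.coeff_X_pow, if_neg (by omega)]
    rw [PowerSeries.coeff_map, IsLocalRing.residue_eq_zero_iff, PadicInt.maximalIdeal_eq_span_p,
      Ideal.mem_span_singleton] at hc
    exact hc
  | succ d ih =>
    have hmul : toIwasawa p (cyclotomicOmega p (j₀ + (d + 1))) = toIwasawa p (cyclotomicOmega p (j₀ + d)) *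
        ((((cyclotomic (p ^ (j₀ + d + 1)) ℤ_[p]).comp (X + 1) : ℤ_[p][X])) : IwasawaAlgebra p) := by
      rw [← add_assoc, cyclotomicOmega_succ, map_mul, toIwasawa_apply ((cyclotomic (p ^ (j₀ + d + 1)) ℤ).comp (X + 1)),
        ChromaticCommonZeros.coe_map_cyclotomic_comp_eq]
    have hl' : l ≤ (p ^ (j₀ + d + 1)).totient := by
      rw [Nat.totient_prime_pow_succ hp.out]
      have h1 : 1 ≤ p - 1 := Nat.le_sub_one_of_lt hp.out.one_lt
      calc l ≤ p ^ j₀ := hl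
        _ ≤ p ^ (j₀ + d) := Nat.pow_le_pow_right hp.out.pos (Nat.le_add_right _ _)
        _ = p ^ (j₀ + d) * 1 := (mul_one _).symm
        _ ≤ p ^ (j₀ + d) * (p - 1) := Nat.mul_le_mul_left _ h1
    rw [hmul, pow_succ]
    exact Ideal.mul_mem_mul ih (coe_cyclotomic_comp_mem_certIdeal hl')

/-- **The monomial `p^{k+1−⌊i/l⌋}·T^i` lies in `(p, T^l)^{k+1}`** (the generators of the graded certificate ideal).
[folklore] -/
theorem C_pow_mul_X_pow_mem_certIdeal_pow (k l i : ℕ) :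
    (PowerSeries.C ((p : ℤ_[p]) ^ (k + 1 - i / l)) : IwasawaAlgebra p) * PowerSeries.X ^ i ∈
      (Ideal.span {(PowerSeries.C (p : ℤ_[p]) : IwasawaAlgebra p), PowerSeries.X ^ l}) ^ (k + 1) := by
  set J : Ideal (IwasawaAlgebra p) :=
    Ideal.span {(PowerSeries.C (p : ℤ_[p]) : IwasawaAlgebra p), PowerSeries.X ^ l} with hJ
  have hCp : (PowerSeries.C (p : ℤ_[p]) : IwasawaAlgebra p) ∈ J := Ideal.subset_span (by simp)
  have hXl : (PowerSeries.X : IwasawaAlgebra p) ^ l ∈ J := Ideal.subset_span (by simp)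
  have hXi : (PowerSeries.X : IwasawaAlgebra p) ^ i ∈ J ^ (i / l) := by
    have h1 : (PowerSeries.X : IwasawaAlgebra p) ^ i = (PowerSeries.X ^ l) ^ (i / l) * PowerSeries.X ^ (i % l) := by
      conv_lhs => rw [← Nat.div_add_mod i l]
      rw [pow_add, pow_mul]
    rw [h1]
    exact Ideal.mul_mem_right _ _ (Ideal.pow_mem_pow hXl _)
  by_cases hq : i / l ≤ k + 1
  · have h1 : (PowerSeries.C ((p : ℤ_[p]) ^ (k + 1 - i / l)) : IwasawaAlgebra p) ∈ J ^ (k + 1 - i / l) := by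
      rw [map_pow]
      exact Ideal.pow_mem_pow hCp _
    have h2 := Ideal.mul_mem_mul h1 hXi
    rwa [← pow_add, Nat.sub_add_cancel hq] at h2
  · push Not at hq
    have h0 : k + 1 - i / l = 0 := Nat.sub_eq_zero_of_le hq.le
    rw [h0, pow_zero, map_one, one_mul]
    exact Ideal.pow_le_pow_right hq.le hXi

/-- **Exact-rational entry of the graded certificate.** A polynomial `R ∈ ℚ[T]` each of whose coefficients is `0` or has
`v_p(R_i) ≥ k+1−⌊i/l⌋` is `ι(E)` for some `E ∈ (p, T^l)^{k+1} ⊆ Λ` (a finite valuation test). [cite: Washington1997, §7.1] -/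
theorem exists_mem_certIdeal_pow_of_padicValRat (R : ℚ[X]) {k l : ℕ}
    (hR : ∀ i, R.coeff i = 0 ∨ ((k + 1 - i / l : ℕ) : ℤ) ≤ padicValRat p (R.coeff i)) :
    ∃ E : IwasawaAlgebra p,
      E ∈ (Ideal.span {(PowerSeries.C (p : ℤ_[p]) : IwasawaAlgebra p), PowerSeries.X ^ l}) ^ (k + 1) ∧
      iwasawaToPowerSeries p E = ((R.map (algebraMap ℚ ℚ_[p]) : ℚ_[p][X]) : PowerSeries ℚ_[p]) := by
  have hp1 : (1 : ℝ) ≤ p := by exact_mod_cast hp.out.one_lt.le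
  -- integral coefficients with the prescribed divisibility
  have hint : ∀ i, ∃ e : ℤ_[p], (e : ℚ_[p]) = algebraMap ℚ ℚ_[p] (R.coeff i) ∧
      e ∈ Ideal.span {(p : ℤ_[p]) ^ (k + 1 - i / l)} := by
    intro i
    by_cases h0 : R.coeff i = 0
    · exact ⟨0, by simp [h0], Ideal.zero_mem _⟩
    have hv : ((k + 1 - i / l : ℕ) : ℤ) ≤ padicValRat p (R.coeff i) := (hR i).resolve_left h0
    have hnorm : ‖((R.coeff i : ℚ) : ℚ_[p])‖ ≤ (p : ℝ) ^ (-((k + 1 - i / l : ℕ) : ℤ)) := by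
      rw [Padic.norm_eq_zpow_neg_valuation (by exact_mod_cast h0), Padic.valuation_ratCast]
      exact zpow_le_zpow_right₀ hp1 (neg_le_neg hv)
    have h1 : ‖((R.coeff i : ℚ) : ℚ_[p])‖ ≤ 1 :=
      hnorm.trans (zpow_le_one_of_nonpos₀ hp1 (by simp))
    refine ⟨⟨_, h1⟩, rfl, ?_⟩
    rw [← PadicInt.norm_le_pow_iff_mem_span_pow]
    exact hnorm
  choose e he hemem using hint
  refine ⟨∑ i ∈ Finset.range (R.natDegree + 1), PowerSeries.monomial i (e i), ?_, ?_⟩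
  · refine Ideal.sum_mem _ fun i _ => ?_
    obtain ⟨d, hd⟩ := Ideal.mem_span_singleton'.mp (hemem i)
    rw [← hd, PowerSeries.monomial_eq_C_mul_X_pow, map_mul, mul_assoc]
    exact Ideal.mul_mem_left _ _ (C_pow_mul_X_pow_mem_certIdeal_pow k l i)
  · ext m
    rw [Wuthrich2014.coeff_iwasawaToPowerSeries, map_sum, Polynomial.coeff_coe, Polynomial.coeff_map]
    simp only [PowerSeries.coeff_monomial]
    rw [Finset.sum_ite_eq]
    by_cases hm : m ∈ Finset.range (R.natDegree + 1)
    · rw [if_pos hm]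
      exact he m
    · rw [if_neg hm]
      rw [Finset.mem_range, not_lt] at hm
      rw [Polynomial.coeff_eq_zero_of_natDegree_lt (by omega), map_zero]
      simp

end Omega

end Summit.BirchSwinnertonDyer.BirchSwinnertonDyer.Theorems.ChromaticRobustBezout

/-! ### §2 From two Mazur–Tate layers to a graded certificate for `(L♯, L♭)` -/
namespace Summit.BirchSwinnertonDyer.BirchSwinnertonDyer.Theorems.ChromaticCommonZeros

open Summit.BirchSwinnertonDyer.BirchSwinnertonDyer.Theorems.ChromaticRobustBezout

section Transfer

variable {W : WeierstrassCurve ℚ} [W.IsElliptic] [W.IsGloballyMinimal] {N : ℕ} [NeZero N]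
  {f : CuspForm (Gamma0 N) 2} {p : ℕ} [hp : Fact p.Prime]

/-- An integer polynomial read in `ℚ_p⟦T⟧` through `Λ` is the same polynomial read through `ℚ` (plumbing). [folklore] -/
theorem iwasawaToPowerSeries_toIwasawa_eq (q : ℤ[X]) :
    iwasawaToPowerSeries p (toIwasawa p q) =
      (((q.map (Int.castRingHom ℚ)).map (algebraMap ℚ ℚ_[p]) : ℚ_[p][X]) : PowerSeries ℚ_[p]) := by
  rw [Polynomial.map_map, RingHom.ext_int ((algebraMap ℚ ℚ_[p]).comp (Int.castRingHom ℚ)) (Int.castRingHom ℚ_[p])]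
  change PowerSeries.map (algebraMap ℤ_[p] ℚ_[p]) (((q.map (Int.castRingHom ℤ_[p])) : ℤ_[p][X]) : PowerSeries ℤ_[p]) = _
  rw [← Polynomial.polynomial_map_coe, Polynomial.map_map,
    RingHom.ext_int ((algebraMap ℤ_[p] ℚ_[p]).comp (Int.castRingHom ℤ_[p])) (Int.castRingHom ℚ_[p])]

/-- `ι(C(p^k)) = C(p^k)` read through `ℚ` (plumbing). [folklore] -/
theorem iwasawaToPowerSeries_C_natCast_pow (k : ℕ) :
    iwasawaToPowerSeries p (PowerSeries.C ((p : ℤ_[p]) ^ k)) =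
      (((Polynomial.C ((p : ℚ) ^ k)).map (algebraMap ℚ ℚ_[p]) : ℚ_[p][X]) : PowerSeries ℚ_[p]) := by
  conv_rhs => rw [Polynomial.map_C, Polynomial.coe_C, map_pow, map_natCast]
  change PowerSeries.map (algebraMap ℤ_[p] ℚ_[p]) (PowerSeries.C ((p : ℤ_[p]) ^ k)) = _
  conv_lhs => rw [PowerSeries.map_C, map_pow, map_natCast]

/-- **Two Mazur–Tate layers give a graded certificate for the Sprung pair** (`p ≠ 2`, good reduction, `p ∣ a_p`, `f` the
newform of `W`): if `ω_{n₁}, ω_{n₂} ∈ J_l^{k+1}` (`J_l = (p, T^l)`; e.g. `n_i ≥ j₀ + k` with `p^{j₀} ≥ l`) and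
`a·θ_{n₁} + b·θ_{n₂} − p^k = ι(E)`, `a, b ∈ ℤ[T]`, `E ∈ J_l^{k+1}`, then `A·L♯ + B·L♭ − C(p^k) ∈ J_l^{k+1}` for some
`A, B ∈ Λ` — from the integral congruences `θ_n = ι(ω_n Q_n − (u_n L♯ + v_n L♭))` (`exists_integral_mazurTate_of_isSprungPair`).
[cite: Sprung2017, Thm. 1.12, Cor. 4.4 and Cor. 4.10] [cite: Pollack2003, Prop. 6.18] -/
theorem exists_gradedBezout_of_mazurTate (hp2 : p ≠ 2) (hf : IsNewformOf W f)
    (hgood : W.HasGoodReductionAtPrime p) (hap : (p : ℤ) ∣ W.frobeniusTrace p)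
    {Lsharp Lflat : IwasawaAlgebra p} (hSP : IsSprungPair f p (W.frobeniusTrace p) Lsharp Lflat)
    {l k n₁ n₂ : ℕ}
    (hω₁ : toIwasawa p (cyclotomicOmega p n₁) ∈
      (Ideal.span {(PowerSeries.C (p : ℤ_[p]) : IwasawaAlgebra p), PowerSeries.X ^ l}) ^ (k + 1))
    (hω₂ : toIwasawa p (cyclotomicOmega p n₂) ∈
      (Ideal.span {(PowerSeries.C (p : ℤ_[p]) : IwasawaAlgebra p), PowerSeries.X ^ l}) ^ (k + 1))
    (a b : ℤ[X]) {E : IwasawaAlgebra p}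
    (hE : E ∈ (Ideal.span {(PowerSeries.C (p : ℤ_[p]) : IwasawaAlgebra p), PowerSeries.X ^ l}) ^ (k + 1))
    (hR : iwasawaToPowerSeries p E =
      (((a.map (Int.castRingHom ℚ) * mazurTateElement f p n₁ + b.map (Int.castRingHom ℚ) * mazurTateElement f p n₂ -
        Polynomial.C ((p : ℚ) ^ k)).map (algebraMap ℚ ℚ_[p]) : ℚ_[p][X]) : PowerSeries ℚ_[p])) :
    ∃ A B : IwasawaAlgebra p, A * Lsharp + B * Lflat - PowerSeries.C ((p : ℤ_[p]) ^ k) ∈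
      (Ideal.span {(PowerSeries.C (p : ℤ_[p]) : IwasawaAlgebra p), PowerSeries.X ^ l}) ^ (k + 1) := by
  obtain ⟨Q₁, hQ₁⟩ := exists_integral_mazurTate_of_isSprungPair hp2 hf hgood hap hSP n₁
  obtain ⟨Q₂, hQ₂⟩ := exists_integral_mazurTate_of_isSprungPair hp2 hf hgood hap hSP n₂
  set u₁ := toIwasawa p (sharpPoly (W.frobeniusTrace p) p n₁) with hu₁
  set v₁ := toIwasawa p (flatPoly (W.frobeniusTrace p) p n₁) with hv₁
  set u₂ := toIwasawa p (sharpPoly (W.frobeniusTrace p) p n₂) with hu₂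
  set v₂ := toIwasawa p (flatPoly (W.frobeniusTrace p) p n₂) with hv₂
  set Θ₁ := toIwasawa p (cyclotomicOmega p n₁) * Q₁ - (u₁ * Lsharp + v₁ * Lflat) with hΘ₁
  set Θ₂ := toIwasawa p (cyclotomicOmega p n₂) * Q₂ - (u₂ * Lsharp + v₂ * Lflat) with hΘ₂
  -- the identity read in `ℚ_p⟦T⟧`, then pulled back to `Λ`
  have hι : iwasawaToPowerSeries p (toIwasawa p a * Θ₁ + toIwasawa p b * Θ₂ - PowerSeries.C ((p : ℤ_[p]) ^ k)) =
      iwasawaToPowerSeries p E := by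
    rw [hR, map_sub, map_add, map_mul, map_mul, ← hQ₁, ← hQ₂, iwasawaToPowerSeries_toIwasawa_eq,
      iwasawaToPowerSeries_toIwasawa_eq, iwasawaToPowerSeries_C_natCast_pow]
    simp only [Polynomial.map_sub, Polynomial.map_add, Polynomial.map_mul, Polynomial.coe_sub, Polynomial.coe_add,
      Polynomial.coe_mul]
  have heq := iwasawaToPowerSeries_injective p hι
  refine ⟨-(toIwasawa p a * u₁ + toIwasawa p b * u₂), -(toIwasawa p a * v₁ + toIwasawa p b * v₂), ?_⟩
  have h1 : -(toIwasawa p a * u₁ + toIwasawa p b * u₂) * Lsharp + -(toIwasawa p a * v₁ + toIwasawa p b * v₂) * Lflat -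
      PowerSeries.C ((p : ℤ_[p]) ^ k) =
      E - (toIwasawa p a * (toIwasawa p (cyclotomicOmega p n₁) * Q₁) +
        toIwasawa p b * (toIwasawa p (cyclotomicOmega p n₂) * Q₂)) := by
    rw [← heq, hΘ₁, hΘ₂]; ring
  rw [h1]
  exact Ideal.sub_mem _ hE (Ideal.add_mem _ (Ideal.mul_mem_left _ _ (Ideal.mul_mem_right _ _ hω₁))
    (Ideal.mul_mem_left _ _ (Ideal.mul_mem_right _ _ hω₂)))

end Transfer

/-! ### §3 (RB0-MT): the X8 door on exact Mazur–Tate data -/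
section RB0MT

variable (W : WeierstrassCurve ℚ) [W.IsElliptic] [W.IsGloballyMinimal] (p : ℕ) [hp : Fact p.Prime]

/-- **(RB0-MT) K1 FOR BOTH COLOURS FROM EXACT MAZUR–TATE DATA: one `λ`-reading layer + a two-layer Bézout certificate.**
On an X8 pair, suppose that for (every) newform `f` of `W` there are: a layer `n₀` with an integral model `Θ₀` of
`θ_{n₀}(f)` (`ι Θ₀ = θ_{n₀}`), `Θ₀ ≠ 0`, `μ(Θ₀) = 0` and `λ(Θ₀) = deg ω⁺_{n₀} + l` (`n₀` odd; reads `μ(L♯) = 0`,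
`λ(L♯) = l`) or `λ(Θ₀) = deg ω⁻_{n₀} + l` (`n₀` even; reads the same for `L♭`); an exponent `j₀` with `l ≤ p^{j₀}`; two
layers `n₁, n₂ ≥ j₀ + k`; integer polynomials `a, b`; and `E ∈ (p, T^l)^{k+1}` with `ι E = a·θ_{n₁} + b·θ_{n₂} − p^k`
(or use `…_of_mazurTateBezout_padicVal`). Then `Theorems.SprungSharpFlatLowerDivisibility W p col` holds for EVERY
colour: `ω_{n_i} ∈ (p, T^l)^{k+1}` (§1), so §2 gives a graded certificate for the Sprung pair, and (RB0)
`sprungSharpFlatLowerDivisibility_of_gradedBezout` applies with the colour read by `lam_{sharp,flat}_eq_of_mazurTate'`.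
CONDITIONAL on the displayed `h714`, `h3`, `hJ` (as R0/RB0); ALL per-pair inputs are EXACT rational data (`θ_{n₀}`,
`θ_{n₁}`, `θ_{n₂}`). Nothing is asserted about any curve.
[cite: Sprung2012, Thm. 7.14 (3) (p. 1504), Prop. 7.19 (p. 1505)] [cite: Sprung2017, Thm. 1.12, Cor. 4.4, Cor. 4.10]
[cite: Pollack2003, Prop. 6.9, Prop. 6.10 and Prop. 6.18] [cite: KuriharaPollack2007, Problem 3.2] -/
theorem sprungSharpFlatLowerDivisibility_of_mazurTateBezout
    (h714 : thm714_sharpFlatSelmerDual_finite_torsion) (h3 : realPeriodRat_eq_unit_mul_plusPeriod_three)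
    (hJ : thm714seq_sharpFlatColemanKato_zetaJoint) (hX : ClassX8 W p)
    (hcert : ∀ {N : ℕ} [NeZero N] (f : CuspForm (Gamma0 N) 2), IsNewformOf W f →
      ∃ (n₀ l j₀ k n₁ n₂ : ℕ) (Θ₀ : IwasawaAlgebra p) (a b : ℤ[X]) (E : IwasawaAlgebra p),
        iwasawaToPowerSeries p Θ₀ = ((mazurTateElement f p n₀).map (algebraMap ℚ ℚ_[p]) : PowerSeries ℚ_[p]) ∧
        Θ₀ ≠ 0 ∧ mu Θ₀ = 0 ∧
        ((Odd n₀ ∧ lam Θ₀ = (cyclotomicOmegaPlus p n₀).natDegree + l) ∨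
          (Even n₀ ∧ lam Θ₀ = (cyclotomicOmegaMinus p n₀).natDegree + l)) ∧
        l ≤ p ^ j₀ ∧ j₀ + k ≤ n₁ ∧ j₀ + k ≤ n₂ ∧
        E ∈ (Ideal.span {(PowerSeries.C (p : ℤ_[p]) : IwasawaAlgebra p), PowerSeries.X ^ l}) ^ (k + 1) ∧
        iwasawaToPowerSeries p E =
          (((a.map (Int.castRingHom ℚ) * mazurTateElement f p n₁ +
              b.map (Int.castRingHom ℚ) * mazurTateElement f p n₂ -
              Polynomial.C ((p : ℚ) ^ k)).map (algebraMap ℚ ℚ_[p]) : ℚ_[p][X]) : PowerSeries ℚ_[p]))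
    (col : Chroma) : SprungSharpFlatLowerDivisibility W p col := by
  refine sprungSharpFlatLowerDivisibility_of_gradedBezout W p h714 h3 hJ hX ?_ col
  intro N _ f hf Lsharp Lflat hSP
  obtain ⟨hp3, ⟨hgood, hap⟩, -⟩ := id hX
  subst hp3
  have hp2 : (3 : ℕ) ≠ 2 := by decide
  obtain ⟨n₀, l, j₀, k, n₁, n₂, Θ₀, a, b, E, hΘ₀, hΘ₀0, hμΘ₀, hread, hl, hn₁, hn₂, hE, hR⟩ := hcert f hf
  -- the two certificate layers carry precision `J_l^{k+1}`
  have hω : ∀ n, j₀ + k ≤ n → toIwasawa 3 (cyclotomicOmega 3 n) ∈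
      (Ideal.span {(PowerSeries.C ((3 : ℕ) : ℤ_[3]) : IwasawaAlgebra 3), PowerSeries.X ^ l}) ^ (k + 1) := by
    intro n hn
    obtain ⟨d, rfl⟩ := Nat.exists_eq_add_of_le hn
    have h := toIwasawa_cyclotomicOmega_mem_certIdeal_pow (p := 3) hl (k + d)
    rw [← add_assoc] at h
    exact Ideal.pow_le_pow_right (by omega) h
  obtain ⟨A, B, hAB⟩ := exists_gradedBezout_of_mazurTate hp2 hf hgood hap hSP (hω n₁ hn₁) (hω n₂ hn₂) a b hE hR
  rcases hread with ⟨hodd, hlam⟩ | ⟨heven, hlam⟩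
  · obtain ⟨hμ, hl'⟩ := lam_sharp_eq_of_mazurTate' hp2 hf hgood hap hSP hodd hΘ₀ hΘ₀0 hμΘ₀ hlam
    refine ⟨Chroma.sharp, A, B, k, by rw [chromaticL_sharp]; exact hμ, ?_⟩
    rw [chromaticL_sharp, hl']
    exact hAB
  · obtain ⟨hμ, hl'⟩ := lam_flat_eq_of_mazurTate' hp2 hf hgood hap hSP heven hΘ₀ hΘ₀0 hμΘ₀ hlam
    refine ⟨Chroma.flat, A, B, k, by rw [chromaticL_flat]; exact hμ, ?_⟩
    rw [chromaticL_flat, hl']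
    exact hAB

/-- **(RB0-MT, valuation form)**: as `sprungSharpFlatLowerDivisibility_of_mazurTateBezout`, the witness `E` replaced by the
finite test «every coefficient `R_i` of `R := a·θ_{n₁} + b·θ_{n₂} − p^k ∈ ℚ[T]` is `0` or has `v_p(R_i) ≥ k+1−⌊i/l⌋`».
CONDITIONAL on `h714`, `h3`, `hJ`; inputs = exact rationals. Nothing is asserted about any curve. [cite: Sprung2012, Thm. 7.14 (3), Prop. 7.19]
[cite: Sprung2017, Thm. 1.12, Cor. 4.4, Cor. 4.10] [cite: Pollack2003, Prop. 6.9, Prop. 6.10 and Prop. 6.18] -/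
theorem sprungSharpFlatLowerDivisibility_of_mazurTateBezout_padicVal
    (h714 : thm714_sharpFlatSelmerDual_finite_torsion) (h3 : realPeriodRat_eq_unit_mul_plusPeriod_three)
    (hJ : thm714seq_sharpFlatColemanKato_zetaJoint) (hX : ClassX8 W p)
    (hcert : ∀ {N : ℕ} [NeZero N] (f : CuspForm (Gamma0 N) 2), IsNewformOf W f →
      ∃ (n₀ l j₀ k n₁ n₂ : ℕ) (Θ₀ : IwasawaAlgebra p) (a b : ℤ[X]),
        iwasawaToPowerSeries p Θ₀ = ((mazurTateElement f p n₀).map (algebraMap ℚ ℚ_[p]) : PowerSeries ℚ_[p]) ∧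
        Θ₀ ≠ 0 ∧ mu Θ₀ = 0 ∧
        ((Odd n₀ ∧ lam Θ₀ = (cyclotomicOmegaPlus p n₀).natDegree + l) ∨
          (Even n₀ ∧ lam Θ₀ = (cyclotomicOmegaMinus p n₀).natDegree + l)) ∧
        l ≤ p ^ j₀ ∧ j₀ + k ≤ n₁ ∧ j₀ + k ≤ n₂ ∧
        ∀ i, (a.map (Int.castRingHom ℚ) * mazurTateElement f p n₁ +
              b.map (Int.castRingHom ℚ) * mazurTateElement f p n₂ - Polynomial.C ((p : ℚ) ^ k)).coeff i = 0 ∨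
          ((k + 1 - i / l : ℕ) : ℤ) ≤ padicValRat p
            ((a.map (Int.castRingHom ℚ) * mazurTateElement f p n₁ +
              b.map (Int.castRingHom ℚ) * mazurTateElement f p n₂ - Polynomial.C ((p : ℚ) ^ k)).coeff i))
    (col : Chroma) : SprungSharpFlatLowerDivisibility W p col := by
  refine sprungSharpFlatLowerDivisibility_of_mazurTateBezout W p h714 h3 hJ hX ?_ col
  intro N _ f hf
  obtain ⟨n₀, l, j₀, k, n₁, n₂, Θ₀, a, b, hΘ₀, hΘ₀0, hμΘ₀, hread, hl, hn₁, hn₂, hval⟩ := hcert f hf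
  obtain ⟨E, hE, hR⟩ := exists_mem_certIdeal_pow_of_padicValRat (p := p) _ hval
  exact ⟨n₀, l, j₀, k, n₁, n₂, Θ₀, a, b, E, hΘ₀, hΘ₀0, hμΘ₀, hread, hl, hn₁, hn₂, hE, hR⟩

end RB0MT

end Summit.BirchSwinnertonDyer.BirchSwinnertonDyer.Theorems.ChromaticCommonZeros

end
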